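import Mathlib
import Literature.Probability.LatticeModels.LebowitzInequality
import HarnessLib

/-!
# Crux `PrecisionLaplacian.InverseMFerromagnet` (stmt-CriticalPhenomena-4798), line `Sketch` —
# stub `stub_ghs_pm` (S5, "GHS with sign flips")

THEOREM-ONLY file (no definitions).  For the spin system `ν_{Λ;K}` of `GKSInequalities` on the sites
`Fin n` with nonnegative couplings `K ≥ 0` on supports of at most two sites, a field vector
`h : Fin n → ℝ` is added by enlarging the index set to `Fin m ⊕ Fin n` (`Sum.elim K h`,
`Sum.elim C singleton`); write `M_x(h)` for the magnetisation at `x`.  We prove, for pointwise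
nonnegative field vectors `A, B, Cf` and every site `x`,

  `M_x(B+A+Cf) + M_x(B−A−Cf) ≤ M_x(B+A−Cf) + M_x(B−A+Cf)`.

Proof: Glimm–Jaffe fourfold replicas `(ξ, χ, ξ', χ')` (`LebowitzInequality`: `repClass`,
`classExp_sum_mul_exp_sum_nonneg`, `sum_repClass_mul_gksWeight4_nonneg`) with the replica-dependent
fields `(B+A+Cf, B+A−Cf, B−A+Cf, B−A−Cf)`: the field part of the replicated Hamiltonian is
`∑_z (B_z A_z + A_z B_z + Cf_z C_z)` in the rotated variables, with nonnegative coefficients, so the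
replicated weight is positive on the monomial class, and `⟨D_x⟩ ≥ 0` is the inequality.
-/

namespace Summit.CriticalPhenomena.Ising3DConformalLimit.Cruxes.InverseMFerromagnet.PartialCovarianceLadder

open Literature.Probability.LatticeModels Finset Matrix

/-- Adding a field vector `h` through the index set `Fin m ⊕ Fin n` multiplies the Boltzmann weight
by `exp(∑_z h_z σ_z)`. [folklore] -/
theorem ghsPm_gksWeight_field (n m : ℕ) (K : Fin m → ℝ) (C : Fin m → Finset (Fin n))
    (h : Fin n → ℝ) (σ : SpinConfig (Fin n)) :
    gksWeight (Finset.univ : Finset (Fin m ⊕ Fin n)) (Sum.elim K h)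
        (Sum.elim C (fun z => ({z} : Finset (Fin n)))) σ =
      gksWeight Finset.univ K C σ * Real.exp (∑ z, h z * spinAt z σ) := by
  unfold gksWeight gksHamiltonian
  rw [← Real.exp_add, Fintype.sum_sum_type]
  simp only [Sum.elim_inl, Sum.elim_inr, spinProduct, Finset.prod_singleton]

/-- A sum over the fourfold replicated configurations of a product of one-replica functions is the
product of the four sums. [folklore] -/
theorem ghsPm_sum_cfg4_prod4 {Λ : Type*} [Fintype Λ] [DecidableEq Λ]
    (f₁ f₂ f₃ f₄ w₁ w₂ w₃ w₄ : SpinConfig Λ → ℝ) :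
    ∑ c : Cfg4 Λ, (f₁ c.1 * w₁ c.1) * (f₂ c.2.1 * w₂ c.2.1) * (f₃ c.2.2.1 * w₃ c.2.2.1) *
        (f₄ c.2.2.2 * w₄ c.2.2.2) =
      (∑ σ, f₁ σ * w₁ σ) * (∑ σ, f₂ σ * w₂ σ) * (∑ σ, f₃ σ * w₃ σ) * (∑ σ, f₄ σ * w₄ σ) := by
  simp only [Fintype.sum_prod_type, ← Finset.mul_sum, ← Finset.sum_mul]

/-- `∑_c D_x(c) w₁(ξ)w₂(χ)w₃(ξ')w₄(χ') = -S₁Z₂Z₃Z₄ + Z₁S₂Z₃Z₄ + Z₁Z₂S₃Z₄ - Z₁Z₂Z₃S₄` for four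
(possibly different) one-replica weights, `Z_k = ∑ w_k`, `S_k = ∑ σ_x w_k`. [folklore] -/
theorem ghsPm_sum_repD_mul_weights {Λ ι : Type*} [Fintype Λ] [DecidableEq Λ] (s : Finset ι)
    (K₁ K₂ K₃ K₄ : ι → ℝ) (C : ι → Finset Λ) (x : Λ) :
    ∑ c : Cfg4 Λ, repD x c * (gksWeight s K₁ C c.1 * gksWeight s K₂ C c.2.1 *
        gksWeight s K₃ C c.2.2.1 * gksWeight s K₄ C c.2.2.2) =
      -(gksSum s K₁ C (spinAt x) * gksSum s K₂ C (fun _ => 1) * gksSum s K₃ C (fun _ => 1) *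
          gksSum s K₄ C (fun _ => 1)) +
        gksSum s K₁ C (fun _ => 1) * gksSum s K₂ C (spinAt x) * gksSum s K₃ C (fun _ => 1) *
          gksSum s K₄ C (fun _ => 1) +
        gksSum s K₁ C (fun _ => 1) * gksSum s K₂ C (fun _ => 1) * gksSum s K₃ C (spinAt x) *
          gksSum s K₄ C (fun _ => 1) -
        gksSum s K₁ C (fun _ => 1) * gksSum s K₂ C (fun _ => 1) * gksSum s K₃ C (fun _ => 1) *
          gksSum s K₄ C (spinAt x) := by
  have key : ∀ c : Cfg4 Λ, repD x c * (gksWeight s K₁ C c.1 * gksWeight s K₂ C c.2.1 *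
      gksWeight s K₃ C c.2.2.1 * gksWeight s K₄ C c.2.2.2) =
      -((spinAt x c.1 * gksWeight s K₁ C c.1) * (1 * gksWeight s K₂ C c.2.1) *
          (1 * gksWeight s K₃ C c.2.2.1) * (1 * gksWeight s K₄ C c.2.2.2)) +
        (1 * gksWeight s K₁ C c.1) * (spinAt x c.2.1 * gksWeight s K₂ C c.2.1) *
          (1 * gksWeight s K₃ C c.2.2.1) * (1 * gksWeight s K₄ C c.2.2.2) +
        (1 * gksWeight s K₁ C c.1) * (1 * gksWeight s K₂ C c.2.1) *
          (spinAt x c.2.2.1 * gksWeight s K₃ C c.2.2.1) * (1 * gksWeight s K₄ C c.2.2.2) -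
        (1 * gksWeight s K₁ C c.1) * (1 * gksWeight s K₂ C c.2.1) *
          (1 * gksWeight s K₃ C c.2.2.1) * (spinAt x c.2.2.2 * gksWeight s K₄ C c.2.2.2) := by
    intro c
    simp only [repD]
    ring
  rw [Finset.sum_congr rfl fun c _ => key c, Finset.sum_sub_distrib, Finset.sum_add_distrib,
    Finset.sum_add_distrib, Finset.sum_neg_distrib,
    ghsPm_sum_cfg4_prod4 (spinAt x) (fun _ => 1) (fun _ => 1) (fun _ => 1),
    ghsPm_sum_cfg4_prod4 (fun _ => 1) (spinAt x) (fun _ => 1) (fun _ => 1),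
    ghsPm_sum_cfg4_prod4 (fun _ => 1) (fun _ => 1) (spinAt x) (fun _ => 1),
    ghsPm_sum_cfg4_prod4 (fun _ => 1) (fun _ => 1) (fun _ => 1) (spinAt x)]
  rfl

/-- The replicated weight with replica-dependent fields `(B+A+Cf, B+A−Cf, B−A+Cf, B−A−Cf)` equals the
fieldless replicated weight times `exp(∑_z B_z A_z) exp(∑_z A_z B_z) exp(∑_z Cf_z C_z)` in the
rotated variables `A, B, C` of Glimm–Jaffe. [folklore] -/
theorem ghsPm_exp_fields_mul_gksWeight4 (n m : ℕ) (K : Fin m → ℝ) (C : Fin m → Finset (Fin n))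
    (A B Cf : Fin n → ℝ) (c : Cfg4 (Fin n)) :
    Real.exp (∑ z, B z * repA z c) * (Real.exp (∑ z, A z * repB z c) *
        (Real.exp (∑ z, Cf z * repC z c) * gksWeight4 Finset.univ K C c)) =
      gksWeight (Finset.univ : Finset (Fin m ⊕ Fin n)) (Sum.elim K (B + A + Cf))
          (Sum.elim C (fun z => ({z} : Finset (Fin n)))) c.1 *
        gksWeight (Finset.univ : Finset (Fin m ⊕ Fin n)) (Sum.elim K (B + A - Cf))
          (Sum.elim C (fun z => ({z} : Finset (Fin n)))) c.2.1 *
        gksWeight (Finset.univ : Finset (Fin m ⊕ Fin n)) (Sum.elim K (B - A + Cf))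
          (Sum.elim C (fun z => ({z} : Finset (Fin n)))) c.2.2.1 *
        gksWeight (Finset.univ : Finset (Fin m ⊕ Fin n)) (Sum.elim K (B - A - Cf))
          (Sum.elim C (fun z => ({z} : Finset (Fin n)))) c.2.2.2 := by
  rw [ghsPm_gksWeight_field, ghsPm_gksWeight_field, ghsPm_gksWeight_field, ghsPm_gksWeight_field]
  have hs : ∑ z, B z * repA z c + ∑ z, A z * repB z c + ∑ z, Cf z * repC z c =
      ∑ z, (B + A + Cf) z * spinAt z c.1 + ∑ z, (B + A - Cf) z * spinAt z c.2.1 +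
        ∑ z, (B - A + Cf) z * spinAt z c.2.2.1 + ∑ z, (B - A - Cf) z * spinAt z c.2.2.2 := by
    simp only [← Finset.sum_add_distrib]
    refine Finset.sum_congr rfl fun z _ => ?_
    simp only [Pi.add_apply, Pi.sub_apply, repA, repB, repC]
    ring
  have he : Real.exp (∑ z, B z * repA z c) * Real.exp (∑ z, A z * repB z c) *
      Real.exp (∑ z, Cf z * repC z c) =
      Real.exp (∑ z, (B + A + Cf) z * spinAt z c.1) * Real.exp (∑ z, (B + A - Cf) z * spinAt z c.2.1) *
        Real.exp (∑ z, (B - A + Cf) z * spinAt z c.2.2.1) *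
        Real.exp (∑ z, (B - A - Cf) z * spinAt z c.2.2.2) := by
    simp only [← Real.exp_add]
    rw [hs]
  simp only [gksWeight4]
  linear_combination (gksWeight Finset.univ K C c.1 * gksWeight Finset.univ K C c.2.1 *
    gksWeight Finset.univ K C c.2.2.1 * gksWeight Finset.univ K C c.2.2.2) * he

/-- The final division: from `0 ≤ -S₁Z₂Z₃Z₄ + Z₁S₂Z₃Z₄ + Z₁Z₂S₃Z₄ - Z₁Z₂Z₃S₄` and `Z_k > 0`,
`S₁/Z₁ + S₄/Z₄ ≤ S₂/Z₂ + S₃/Z₃`. [folklore] -/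
theorem ghsPm_div_step {S₁ S₂ S₃ S₄ Z₁ Z₂ Z₃ Z₄ : ℝ} (hZ₁ : 0 < Z₁) (hZ₂ : 0 < Z₂) (hZ₃ : 0 < Z₃)
    (hZ₄ : 0 < Z₄)
    (h : 0 ≤ -(S₁ * Z₂ * Z₃ * Z₄) + Z₁ * S₂ * Z₃ * Z₄ + Z₁ * Z₂ * S₃ * Z₄ - Z₁ * Z₂ * Z₃ * S₄) :
    S₁ / Z₁ + S₄ / Z₄ ≤ S₂ / Z₂ + S₃ / Z₃ := by
  rw [← sub_nonneg]
  have e : S₂ / Z₂ + S₃ / Z₃ - (S₁ / Z₁ + S₄ / Z₄) =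
      (-(S₁ * Z₂ * Z₃ * Z₄) + Z₁ * S₂ * Z₃ * Z₄ + Z₁ * Z₂ * S₃ * Z₄ - Z₁ * Z₂ * Z₃ * S₄) /
        (Z₁ * Z₂ * Z₃ * Z₄) := by
    field_simp
    ring
  rw [e]
  exact div_nonneg h (by positivity)

/-- **GHS with sign flips** (stub `stub_ghs_pm`): for nonnegative field vectors `A, B, Cf` and any
site `x`, `M_x(B+A+Cf) + M_x(B−A−Cf) ≤ M_x(B+A−Cf) + M_x(B−A+Cf)`, by the fourfold-replica class
positivity of Glimm–Jaffe with replica-dependent fields and the monomial `D_x`. [folklore] -/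
theorem stub_ghs_pm : ∀ (n m : ℕ) (K : Fin m → ℝ) (C : Fin m → Finset (Fin n)), (∀ i, 0 ≤ K i) → (∀ i, (C i).card ≤ 2) → ∀ (A B Cf : Fin n → ℝ), (∀ z, 0 ≤ A z) → (∀ z, 0 ≤ B z) → (∀ z, 0 ≤ Cf z) → ∀ x : Fin n, gksExpect (Finset.univ : Finset (Fin m ⊕ Fin n)) (Sum.elim K (B + A + Cf)) (Sum.elim C (fun z => ({z} : Finset (Fin n)))) (spinAt x) + gksExpect (Finset.univ : Finset (Fin m ⊕ Fin n)) (Sum.elim K (B - A - Cf)) (Sum.elim C (fun z => ({z} : Finset (Fin n)))) (spinAt x) ≤ gksExpect (Finset.univ : Finset (Fin m ⊕ Fin n)) (Sum.elim K (B + A - Cf)) (Sum.elim C (fun z => ({z} : Finset (Fin n)))) (spinAt x) + gksExpect (Finset.univ : Finset (Fin m ⊕ Fin n)) (Sum.elim K (B - A + Cf)) (Sum.elim C (fun z => ({z} : Finset (Fin n)))) (spinAt x) := by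
  intro n m K C hK hC A B Cf hA hB hCf x
  -- (i) positivity of the replicated weight with fields on the monomial class
  have h0 := sum_repClass_mul_gksWeight4_nonneg (Finset.univ : Finset (Fin m)) K C
    (fun i _ => hK i) (fun i _ => hC i)
  have h1 := classExp_sum_mul_exp_sum_nonneg repClass_mul_mem h0 Finset.univ Cf repC
    (fun z _ => hCf z) (fun z _ => repC_mem_repClass z)
  have h2 := classExp_sum_mul_exp_sum_nonneg repClass_mul_mem h1 Finset.univ A repB
    (fun z _ => hA z) (fun z _ => repB_mem_repClass z)
  have h3 := classExp_sum_mul_exp_sum_nonneg repClass_mul_mem h2 Finset.univ B repA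
    (fun z _ => hB z) (fun z _ => repA_mem_repClass z) (repD x) (repD_mem_repClass x)
  -- (ii) factorisation into the four field weights, (iii) the monomial `D_x`
  have h4 := le_of_le_of_eq h3 (Finset.sum_congr rfl fun c _ =>
    congrArg (repD x c * ·) (ghsPm_exp_fields_mul_gksWeight4 n m K C A B Cf c))
  rw [ghsPm_sum_repD_mul_weights] at h4
  unfold gksExpect
  exact ghsPm_div_step (gksSum_one_pos _ _ _) (gksSum_one_pos _ _ _) (gksSum_one_pos _ _ _)
    (gksSum_one_pos _ _ _) h4

end Summit.CriticalPhenomena.Ising3DConformalLimit.Cruxes.InverseMFerromagnet.PartialCovarianceLadder
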